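import Mathlib
import Summits.Ventures.HodgeRepro.OcticCMPointEightIdeal

/-!
# OcticCMPointSixModel — the ring `𝒪/𝔭⁶` at `𝔭 | 5` of the octic point as the quotient `𝒪/𝔭⁸ ⧸ (5w²)`

Blind re-derivation cell `pub-hodge-repro`, seat night-2 (gen 5).  Target tree path
`lean/Summits/Ventures/HodgeRepro/OcticCMPointSixModel.lean`.  The even conductor between gen 4's `c = 4`
(`𝔽₅[ϖ]/(ϖ⁴)`) and gen 5's `c = 8` (`ℤ/25[w]/(w⁴ + 5w² + 5)`): `𝒪/𝔭⁶` is NOT a monogenic quotient of a polynomial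
ring over `ℤ/25` with a power basis (as an abelian group it is `(ℤ/25)² × (ℤ/5)²`), so it is transcribed as the
**quotient of `R8 = 𝒪/𝔭⁸` by `J = 𝔭⁶/𝔭⁸ = (5w²)`** (`w⁶ = 20w² = −5w²`, so `(w⁶) = (5w²)`):

* `R6 = R8 ⧸ J`, the quotient map `q`, `|R6| = 5⁶` (`card_R6`: `|R8| = |J| · |R6|`, `|J| = 25` — `J = Ann(w²)`);
* the conjugation `σ₆` descends (`conj_mem_J`), an involution (`conj6_conj6`);
* **the additive character `ψ̃₆(ȳ) = ψ̃₈(w² y)`** (`psi6`): well defined since `w² J ⊆ ker ψ̃₈`, PRIMITIVE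
  (`psi6_isPrimitive`: `ψ̃₈(w² a ·) ≡ 1` forces `w² a = 0`, i.e. `a ∈ Ann(w²) = J`, `ann_w_sq`), `σ`-odd
  (`psi6_conj6`);
* **the ideal `I₆ = 𝔭³/𝔭⁶ = q((w³))`** (`I6`): `I₆ · I₆ = 0` (`w⁶ ∈ J`), `σ₆(I₆) ⊆ I₆`, and **its `ψ̃₆`-annihilator is
  `I₆`** (`psiAnn_I6_iff`: `ψ̃₈(w⁵ x ·) ≡ 1` forces `w⁵ x = 0`, i.e. `x ∈ Ann(w⁵) = (w³)`, `ann_w_five`).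

The root numbers at conductor `6` follow in `OcticCMPointSixSign.lean` from the even-conductor theorem.
Numerics: `numerics/six_model.py` (`|J| = 25`, `Ann(w²) = J`, `Ann(w⁵) = (w³)`, `|(w³)/J| = 125`).

**What this is not.**  `|I₆| = 125` is not computed here (the statements take `κ` with `κ |I₆| = 1`); conductors `5`
and `7` (odd) are not transcribed.  Nothing here says anything about the status of the Hodge conjecture for CM
abelian varieties, which is NOT proved.
-/

set_option autoImplicit false

noncomputable section

open Polynomial Classical

namespace Summit.Ventures.HodgeRepro.PeriodCloser

namespace SixModel

open GaussSumStability EightModel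

/-! ### Coordinates of `w² a`, `w⁵ a`, and the annihilators -/

/-- `w⁴ = 20 + 20w²`. -/
theorem w_pow_four : w ^ 4 = 20 + 20 * w ^ 2 := by
  have hrel := w_rel
  have h25 := twentyfive_eq_zero
  linear_combination hrel - (w ^ 2 + 1) * h25

/-- `w⁵ = 20w + 20w³`. -/
theorem w_pow_five : w ^ 5 = 20 * w + 20 * w ^ 3 := by
  have hrel := w_rel
  have h25 := twentyfive_eq_zero
  linear_combination w * hrel - (w ^ 3 + w) * h25

/-- `w⁶ = 20w²`. -/
theorem w_pow_six : w ^ 6 = 20 * w ^ 2 := by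
  have hrel := w_rel
  have h25 := twentyfive_eq_zero
  linear_combination (w ^ 2 - 5) * hrel + h25

/-- `w⁷ = 20w³`. -/
theorem w_pow_seven : w ^ 7 = 20 * w ^ 3 := by
  have h6 := w_pow_six
  calc w ^ 7 = w ^ 6 * w := by ring
    _ = 20 * w ^ 3 := by rw [h6]; ring

/-- **`w² a` in coordinates**: `w²(c₀ + c₁w + c₂w² + c₃w³) = 20c₂ + 20c₃ w + (c₀ + 20c₂) w² + (c₁ + 20c₃) w³`. -/
theorem w_sq_mul_comb (c₀ c₁ c₂ c₃ : ZMod 25) :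
    w ^ 2 * (c₀ • (1 : R8) + c₁ • w + c₂ • w ^ 2 + c₃ • w ^ 3) =
      (20 * c₂) • (1 : R8) + (20 * c₃) • w + (c₀ + 20 * c₂) • w ^ 2 + (c₁ + 20 * c₃) • w ^ 3 := by
  have h4 := w_pow_four
  have h5 := w_pow_five
  have h20 : algebraMap (ZMod 25) R8 20 = 20 := map_ofNat _ _
  simp only [smul_eq_num, map_add, map_mul, h20]
  linear_combination (algebraMap (ZMod 25) R8 c₂) * h4 + (algebraMap (ZMod 25) R8 c₃) * h5

/-- **`w⁵ a` in coordinates**: `w⁵(c₀ + c₁w + c₂w² + c₃w³) = 20c₀ w + 20c₁ w² + (20c₀ + 20c₂) w³`. -/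
theorem w_five_mul_comb (c₀ c₁ c₂ c₃ : ZMod 25) :
    w ^ 5 * (c₀ • (1 : R8) + c₁ • w + c₂ • w ^ 2 + c₃ • w ^ 3) =
      (0 : ZMod 25) • (1 : R8) + (20 * c₀) • w + (20 * c₁) • w ^ 2 + (20 * c₀ + 20 * c₂) • w ^ 3 := by
  have h5 := w_pow_five
  have h6 := w_pow_six
  have h7 := w_pow_seven
  have h8 := w_pow_eight
  have h20 : algebraMap (ZMod 25) R8 20 = 20 := map_ofNat _ _
  simp only [smul_eq_num, map_add, map_mul, map_zero, h20]
  linear_combination (algebraMap (ZMod 25) R8 c₀) * h5 + (algebraMap (ZMod 25) R8 c₁) * h6 +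
    (algebraMap (ZMod 25) R8 c₂) * h7 + (algebraMap (ZMod 25) R8 c₃) * h8

/-- The coordinates of `y` are `b4.repr y`, and `y = 0` iff all four vanish. -/
theorem eq_zero_iff_coords (c₀ c₁ c₂ c₃ : ZMod 25) :
    c₀ • (1 : R8) + c₁ • w + c₂ • w ^ 2 + c₃ • w ^ 3 = 0 ↔ c₀ = 0 ∧ c₁ = 0 ∧ c₂ = 0 ∧ c₃ = 0 := by
  constructor
  · intro h
    have hc : ∀ i : Fin 4, ![c₀, c₁, c₂, c₃] i = 0 := fun i => by
      rw [← coords_comb, h, map_zero]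
      rfl
    exact ⟨hc 0, hc 1, hc 2, hc 3⟩
  · rintro ⟨rfl, rfl, rfl, rfl⟩
    simp

/-- **The ideal `J = (5w²) = 𝔭⁶/𝔭⁸`.** -/
def J : Ideal R8 := Ideal.span {5 * w ^ 2}

/-- `y ∈ J ↔ y = 5w² b`. -/
theorem mem_J_iff (y : R8) : y ∈ J ↔ ∃ b, y = 5 * w ^ 2 * b := by
  rw [J, Ideal.mem_span_singleton']
  constructor
  · rintro ⟨b, hb⟩
    exact ⟨b, by rw [← hb, mul_comm]⟩
  · rintro ⟨b, hb⟩
    exact ⟨b, by rw [hb, mul_comm]⟩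

/-- `20 c = 0` in `ℤ/25` means `c = 5 d`. -/
theorem eq_five_mul_of_twenty_mul_eq_zero (c : ZMod 25) (h : 20 * c = 0) : ∃ d : ZMod 25, c = 5 * d := by
  revert c; decide

/-- `c₀ + 20 c₂ = 0` and `20 c₂ = 0` force `c₀ = 0` in `ℤ/25`. -/
theorem eq_zero_of_add_twenty (c₀ c₂ : ZMod 25) (h : c₀ + 20 * c₂ = 0) (h2 : 20 * c₂ = 0) : c₀ = 0 := by
  revert c₀ c₂; decide

/-- **`Ann(w²) = J`**: `w² a = 0` forces `a ∈ (5w²)`. -/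
theorem ann_w_sq {a : R8} (h : w ^ 2 * a = 0) : a ∈ J := by
  rw [eq_comb a, w_sq_mul_comb, eq_zero_iff_coords] at h
  obtain ⟨h0, h1, h2, h3⟩ := h
  have hc0 : b4.repr a 0 = 0 := eq_zero_of_add_twenty _ _ h2 h0
  have hc1 : b4.repr a 1 = 0 := eq_zero_of_add_twenty _ _ h3 h1
  obtain ⟨d2, hd2⟩ := eq_five_mul_of_twenty_mul_eq_zero _ h0
  obtain ⟨d3, hd3⟩ := eq_five_mul_of_twenty_mul_eq_zero _ h1
  rw [mem_J_iff]
  refine ⟨algebraMap (ZMod 25) R8 d2 + algebraMap (ZMod 25) R8 d3 * w, ?_⟩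
  conv_lhs => rw [eq_comb a]
  rw [hc0, hc1, hd2, hd3]
  simp only [smul_eq_num, map_mul, map_zero, map_ofNat]
  ring

/-- **`Ann(w⁵) = (w³)`**: `w⁵ a = 0` forces `a ∈ (w³)` — the coordinates `c₀, c₁, c₂` of `a` lie in `5ℤ/25`, and
`5 = w³ (w³ − w)` (from `w⁴ = −5w² − 5` and `w⁶ = −5w²`), so `a = w³ · ((w³ − w)(d₀ + d₁w + d₂w²) + c₃)`. -/
theorem ann_w_five {a : R8} (h : w ^ 5 * a = 0) : ∃ y : R8, a = w ^ 3 * y := by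
  rw [eq_comb a, w_five_mul_comb, eq_zero_iff_coords] at h
  obtain ⟨-, h1, h2, h3⟩ := h
  obtain ⟨d0, hd0⟩ := eq_five_mul_of_twenty_mul_eq_zero _ h1
  obtain ⟨d1, hd1⟩ := eq_five_mul_of_twenty_mul_eq_zero _ h2
  have h2' : 20 * b4.repr a 2 = 0 := by
    have : 20 * b4.repr a 2 = (20 * b4.repr a 0 + 20 * b4.repr a 2) - 20 * b4.repr a 0 := by ring
    rw [this, h3, h1, sub_zero]
  obtain ⟨d2, hd2⟩ := eq_five_mul_of_twenty_mul_eq_zero _ h2'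
  have h5 : (5 : R8) = w ^ 3 * (w ^ 3 - w) := by
    have hrel := w_rel
    have h6 := w_pow_six
    have h25 := twentyfive_eq_zero
    linear_combination hrel - h6 - w ^ 2 * h25
  refine ⟨(w ^ 3 - w) * (algebraMap (ZMod 25) R8 d0 + algebraMap (ZMod 25) R8 d1 * w +
    algebraMap (ZMod 25) R8 d2 * w ^ 2) + algebraMap (ZMod 25) R8 (b4.repr a 3), ?_⟩
  conv_lhs => rw [eq_comb a]
  rw [hd0, hd1, hd2]
  simp only [smul_eq_num, map_mul, map_ofNat]
  rw [h5]
  ring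

/-! ### The quotient `R6 = 𝒪/𝔭⁶` -/

/-- **`R6 = 𝒪/𝔭⁶ = R8 ⧸ (5w²)`.** -/
abbrev R6 : Type := R8 ⧸ J

/-- The quotient map `q : 𝒪/𝔭⁸ → 𝒪/𝔭⁶`. -/
abbrev q : R8 →+* R6 := Ideal.Quotient.mk J

/-- `q` is surjective. -/
theorem q_surjective : Function.Surjective q := Ideal.Quotient.mk_surjective

/-- `q y = 0 ↔ y ∈ J`. -/
theorem q_eq_zero_iff (y : R8) : q y = 0 ↔ y ∈ J := Ideal.Quotient.eq_zero_iff_mem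

/-- `5 w² = 0` in `R6`. -/
theorem q_five_w_sq : q (5 * w ^ 2) = 0 := (q_eq_zero_iff _).2 ((mem_J_iff _).2 ⟨1, by ring⟩)

/-- `w⁶ = 0` in `R6`. -/
theorem q_w_pow_six : q (w ^ 6) = 0 := by
  rw [w_pow_six, show (20 : R8) * w ^ 2 = 4 * (5 * w ^ 2) by ring, map_mul, q_five_w_sq, mul_zero]

/-- `R6` is finite. -/
instance instFintypeR6 : Fintype R6 := Fintype.ofFinite _

/-- `σ(J) ⊆ J`: `σ(5w² b) = 5 (−w)² σ(b)`. -/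
theorem conj_mem_J (y : R8) (hy : y ∈ J) : conj y ∈ J := by
  obtain ⟨b, rfl⟩ := (mem_J_iff y).1 hy
  rw [mem_J_iff]
  refine ⟨conj b, ?_⟩
  rw [map_mul, map_mul, map_ofNat, map_pow, conj_w, neg_sq]

/-- **The conjugation of `𝒪/𝔭⁶`**, descended from `σ : w ↦ −w`. -/
def conj6 : R6 →+* R6 :=
  Ideal.Quotient.lift J (q.comp σ8) (fun a ha => by
    rw [RingHom.comp_apply, σ8_apply]
    exact (q_eq_zero_iff _).2 (conj_mem_J a ha))

/-- `σ₆ (q y) = q (σ y)`. -/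
theorem conj6_q (y : R8) : conj6 (q y) = q (conj y) := Ideal.Quotient.lift_mk _ _ _

/-- `σ₆` is an involution. -/
theorem conj6_conj6 (x : R6) : conj6 (conj6 x) = x := by
  obtain ⟨y, rfl⟩ := q_surjective x
  rw [conj6_q, conj6_q, conj_conj]

/-! ### The additive character `ψ̃₆(ȳ) = ψ̃₈(w² y)` -/

/-- `top (w² ·)` as a `ℤ/25`-linear map on `R8`. -/
def top6L : R8 →ₗ[ZMod 25] ZMod 25 := topL.comp (LinearMap.mulLeft (ZMod 25) (w ^ 2))

/-- `top6L y = top (w² y)`. -/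
theorem top6L_apply (y : R8) : top6L y = top (w ^ 2 * y) := rfl

/-- `top6L` vanishes on `J`: `top(w² · 5w² b) = top(5 w⁴ b) = 5 · top(w⁴ b)`, and `w⁴ b = 20 b + 20 w² b`. -/
theorem top6L_mem_J (y : R8) (hy : y ∈ J) : top6L y = 0 := by
  obtain ⟨b, rfl⟩ := (mem_J_iff y).1 hy
  rw [top6L_apply, show w ^ 2 * (5 * w ^ 2 * b) = (5 : ZMod 25) • (w ^ 4 * b) by
    rw [smul_eq_num, map_ofNat]; ring, top_smul, w_pow_four,
    show (20 + 20 * w ^ 2) * b = (20 : ZMod 25) • b + (20 : ZMod 25) • (w ^ 2 * b) by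
      rw [smul_eq_num, smul_eq_num, map_ofNat]; ring, top_add, top_smul, top_smul]
  have : ∀ x y' : ZMod 25, (5 : ZMod 25) * (20 * x + 20 * y') = 0 := by decide
  exact this _ _

/-- **`top₆ : 𝒪/𝔭⁶ → ℤ/25`**, the descent of `top (w² ·)`. -/
def top6 : R6 →+ ZMod 25 :=
  QuotientAddGroup.lift J.toAddSubgroup top6L.toAddMonoidHom (fun y hy => top6L_mem_J y hy)

/-- `top₆ (q y) = top (w² y)`. -/
theorem top6_q (y : R8) : top6 (q y) = top (w ^ 2 * y) := rfl

/-- **The additive character `ψ̃₆` of `𝒪/𝔭⁶`.** -/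
def psi6 : AddChar R6 ℂ := psi25.compAddMonoidHom top6

/-- `ψ̃₆ (q y) = ψ̃₈ (w² y)`. -/
theorem psi6_q (y : R8) : psi6 (q y) = psiTilde (w ^ 2 * y) := rfl

/-- **`ψ̃₆` is primitive**: `ψ̃₆(ā ·) ≡ 1` means `ψ̃₈(w² a ·) ≡ 1` on `R8`, hence `w² a = 0`, hence `a ∈ J`, `ā = 0`. -/
theorem psi6_isPrimitive : psi6.IsPrimitive := by
  intro x hx h1
  obtain ⟨a, rfl⟩ := q_surjective x
  apply hx
  rw [q_eq_zero_iff]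
  apply ann_w_sq
  by_contra hne
  apply psiTilde_isPrimitive hne
  ext b
  rw [AddChar.mulShift_apply, AddChar.one_apply]
  have := DFunLike.congr_fun h1 (q b)
  rw [AddChar.mulShift_apply, AddChar.one_apply, ← map_mul, psi6_q] at this
  rw [show w ^ 2 * a * b = w ^ 2 * (a * b) by ring]
  exact this

/-- `ψ̃₆(σ₆ x) = ψ̃₆(−x)`: `w² σ(y) = σ(w² y)` and `ψ̃₈ ∘ σ = ψ̃₈ ∘ (−1·)`. -/
theorem psi6_conj6 (x : R6) : psi6 (conj6 x) = psi6 (-x) := by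
  obtain ⟨y, rfl⟩ := q_surjective x
  rw [conj6_q, ← map_neg, psi6_q, psi6_q, show w ^ 2 * conj y = conj (w ^ 2 * y) by
    rw [map_mul, map_pow, conj_w, neg_sq], psiTilde_conj, mul_neg]

/-! ### The ideal `I₆ = 𝔭³/𝔭⁶ = q((w³))` -/

/-- **The ideal `I₆ = (w³)` of `𝒪/𝔭⁶`.** -/
def I6 : Ideal R6 := Ideal.span {q (w ^ 3)}

/-- `x ∈ I₆ ↔ x = q(w³ y)` for some `y`. -/
theorem mem_I6_iff (x : R6) : x ∈ I6 ↔ ∃ y : R8, x = q (w ^ 3 * y) := by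
  rw [I6, Ideal.mem_span_singleton']
  constructor
  · rintro ⟨b, hb⟩
    obtain ⟨y, rfl⟩ := q_surjective b
    exact ⟨y, by rw [← hb, ← map_mul, mul_comm]⟩
  · rintro ⟨y, hy⟩
    exact ⟨q y, by rw [hy, map_mul, mul_comm]⟩

/-- **`I₆ · I₆ = 0`** (`w⁶ ∈ J`). -/
theorem I6_sq (z : R6) (hz : z ∈ I6) (z' : R6) (hz' : z' ∈ I6) : z * z' = 0 := by
  obtain ⟨y, rfl⟩ := (mem_I6_iff z).1 hz
  obtain ⟨y', rfl⟩ := (mem_I6_iff z').1 hz'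
  rw [← map_mul, show w ^ 3 * y * (w ^ 3 * y') = w ^ 6 * (y * y') by ring, map_mul, q_w_pow_six, zero_mul]

/-- `σ₆(I₆) ⊆ I₆`. -/
theorem conj6_mem_I6 (z : R6) (hz : z ∈ I6) : conj6 z ∈ I6 := by
  obtain ⟨y, rfl⟩ := (mem_I6_iff z).1 hz
  rw [mem_I6_iff, conj6_q, map_mul, map_pow, conj_w]
  exact ⟨-conj y, by congr 1; ring⟩

/-- **The `ψ̃₆`-annihilator of `I₆` is `I₆`**: `ψ̃₆(x̄ · q(w³ b)) = ψ̃₈(w⁵ x b) ≡ 1` forces `w⁵ x = 0`, i.e. `x ∈ (w³)`. -/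
theorem psiAnn_I6_iff (x : R6) : PsiAnn psi6 I6 x ↔ x ∈ I6 := by
  constructor
  · intro h
    obtain ⟨a, rfl⟩ := q_surjective x
    have h5 : w ^ 5 * a = 0 := by
      by_contra hne
      apply psiTilde_isPrimitive hne
      ext b
      rw [AddChar.mulShift_apply, AddChar.one_apply]
      have := h (q (w ^ 3 * b)) ((mem_I6_iff _).2 ⟨b, rfl⟩)
      rw [← map_mul, psi6_q] at this
      rw [show w ^ 5 * a * b = w ^ 2 * (a * (w ^ 3 * b)) by ring]
      exact this
    obtain ⟨y, hy⟩ := ann_w_five h5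
    exact (mem_I6_iff _).2 ⟨y, by rw [hy]⟩
  · intro hx z hz
    rw [I6_sq x hx z hz, AddChar.map_zero_eq_one]

end SixModel

end Summit.Ventures.HodgeRepro.PeriodCloser

end
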